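import Summits.QuantumFields.BalabanUV.Beta.GAN24.Lin4Additive
import Summits.QuantumFields.BalabanUV.Beta.GAN24.WSlotT2OfPieces
import Summits.QuantumFields.BalabanUV.Beta.SecondOrderRemainderTables
import Summits.QuantumFields.BalabanUV.Beta.TameKernelCalculus
import Summits.QuantumFields.BalabanUV.Gaps.CapTailPinnedLimitSign
import Literature.MathematicalPhysics.QuantumFieldTheory.Balaban1983to89.Beta.ScalewiseWitness

/-!
# `BalabanUV.Gaps.D1PinnedPositionTableAffine` — cell pub-balaban-gaps, row (D1), seat g1-p1: THE POSITION-TABLE TWIN of `Gaps/D1PinnedBorderWeightAffine` —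
# the pinned literal's one-loop coefficients are AFFINE along every line `s ↦ (1 − s)•T₀ + s•T₁` of an3's Wilson two-bond position tables (the table enters
# only member `0` of an2's `T2Of`, through `wilsonW₂`, linearly — an3's `wilsonW₂_add ∕ wilsonW₂_smul`); hence, hypothesis-free at the pin, the limit is
# affine along the line and (D1) at the β-lead's pinned literal is either blind to the position on the line or met at EXACTLY ONE of its points

HONEST FRAMING (cell rule, page 1 of everything): [folklore] kernel algebra BY NAME, the proofs of `Gaps/D1PinnedBorderWeightAffine` (this seat, GEN 9, p370181) with the
varying datum moved from the border weight `cB` to the position table, over an2's `BalabanStepW2.T2Of ∕ WbalOf ∕ e4OfW ∕ T2Of_loc ∕ vertexFamily₂_WbalOf'`, an4's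
`decays_KInvStep ∕ hTA_TbalOf`, gan24's `T2RecursionAffine.W2SymOfK_eq_add_vsym ∕ K3OfK_eq_sub_of_W ∕ lin4` and `Lin4Additive.lin4_add ∕ lin4_smul ∕ vsym_add ∕ vsym_smul`,
the β sub-cell's `tadpole_add ∕ tadpole_smul ∕ secondMoment_add ∕ secondMoment_smul`, an1's `TbalOf_JsBalAn1`, g1-p3's `tendsto_pinned ∕ d1Drift_pinned_iff_lim_eq` and
an3's `WilsonBiStencil.wilsonW₂_add ∕ wilsonW₂_smul`; the four small GEN 9 lemmas it leans on (the §1 read-out lemma, `abs_smul_le_of_locStencil₂`, `hessKer_affine_W`,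
`JsBal0Of_S_indep`) are RE-DERIVED PRIVATELY (statements and proofs verbatim) because `Gaps/D1PinnedBorderWeightAffine` has no farm olean at the time of writing.  NOTHING of Bałaban's is asserted beyond print; which table is print's
(an3's `T` «by value») and whether the limit actually varies along any line are NOT decided; 0 coefficients certified; (D1) NOT discharged; 0∕4 row-D1 binders;
NOT `BetaPertH`, NOT the continuum limit, NOT Clay.  HONEST DEPENDENCY (b2b cell, verbatim): «continuum YM on T⁴ ⇐ BetaPertH ∧ nine spine estimates (0/9 proved);
BetaPertH ⇐ (D1) ∧ (D4) ∧ CAP+tail; G-an2-4 gates asym, D1 and NE2/3/4.»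

CONTENT (all [folklore]; no `def`, no `def … : Prop`, nothing cited as a hypothesis, 0 sorry): §1 **`T2Of_table_affine`**; §2 **`WbalOf_T2Of_table_affine`**;
§3 (`d = 3`, any `cE₂ cB`, any box root) **`TbalOf_JsBalAn1_table_affine`**, **`secondMoment_JsBalAn1_table_affine`**; §4 (the pin, `2 ≤ Lc`, hypothesis-free)
**`lim_JsBalAn1_table_affine`**, **`d1Drift_JsBalAn1_iff_base_of_tableBlind`**, **`exists_tableLine_lim_eq`**, **`existsUnique_tableLine_d1Drift`**,
**`exists_tableLine_limPos_and_limNeg`**; §5 **`lim_JsBalAn1_table_smul`**, **`lim_JsBalAn1_table_add`** — the TABLE RESPONSE `Tc ↦ lim β⁰(cB,Tc) − lim β⁰(cB,0)`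
is HOMOGENEOUS and ADDITIVE: a LINEAR functional on the `4⁴`-dimensional space of position tables (hypothesis-free).  READING (zero classification weight): together with the border-weight file, «(D1) at the pinned literal» is ONE
AFFINE EQUATION in the unpinned second-order data `(cB, Tc)` — affine in `cB` and affine along every table line —, so its evidential weight for the wall is the
weight of print's values of those data ((P6)); nothing here decides the BLIND∕GENERIC alternative.

ABSOLUTE RULE (cell charter, verbatim): «No internally-minted statement may enter as a cited fact. Every hypothesis is either kernel-proved in this
package or a verbatim quotation of a PUBLISHED theorem with page reference. The manuscript(s) under audit are NOT citable for their own disputed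
steps — they are the thing under adjudication; programme-internal (2001/route/tribunal) claims are never citable.»

Provenance: cell pub-balaban-gaps, seat g1-p1, drafted GEN 9 (prover-pub-balaban-gaps-g1-p1-g9-0) as an importer of `Gaps/D1PinnedBorderWeightAffine`, re-cut and extended
(§5) GEN 10 (prover-pub-balaban-gaps-g1-p1-g10-0), 2026-08-23; imports gan24's `GAN24.Lin4Additive` ∕ `GAN24.WSlotT2OfPieces`, the β sub-cell's `SecondOrderRemainderTables` ∕
`TameKernelCalculus`, g1-p3's `Gaps/CapTailPinnedLimitSign`, and the Literature `Beta.ScalewiseWitness` ONLY (all with farm oleans); no existing file touched.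
-/

noncomputable section

open Finset
open scoped BigOperators
open Literature.MathematicalPhysics.QuantumFieldTheory
open Literature.MathematicalPhysics.QuantumFieldTheory.Balaban1983to89
open Literature.MathematicalPhysics.QuantumFieldTheory.Balaban1983to89.Beta
open ExpKernelCalculus (MKer Decays BiLoc VertexFamily₂ comp)
open OneStepResolventKernel (Fib decays_mono biLoc_mono)
open OneStepKernelFamily (KInvStep decays_KInvStep)
open SecondOrderResponse (W2SymOfK LocStencilFM)
open BalabanCompositeJets (LocStencil₂)
open BalabanStepJetsSucc (mmRead)
open BalabanStepW2 (Spure M1 M2Of WbalOf T2Of T2Of_zero T2Of_succ T2Of_loc e4OfW K3OfK wV4 wB2 vertexFamily₂_WbalOf')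
open StepJetData (mfNeg)
open WilsonBiStencil (wilsonW₂)
open Summit.QuantumFields.BalabanUV.Beta.GAN24.ThirdJetKernel (mmRead_sub)
open Summit.QuantumFields.BalabanUV.Beta.GAN24.T2RecursionAffine (vsym lin4 lin4_apply W2SymOfK_eq_add_vsym K3OfK_eq_sub_of_W)
open Summit.QuantumFields.BalabanUV.Beta.GAN24.Lin4Additive (lin4_add lin4_smul vsym_add vsym_smul)
open Summit.QuantumFields.BalabanUV.Beta.GAN24.WSlotT2OfPieces (locStencil₂_zero)
open Summit.QuantumFields.BalabanUV.Beta.SecondOrderRemainderTables (abs_le_of_locStencil₂)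
open WilsonBiStencil (wilsonW₂_add wilsonW₂_smul)
open Filter Topology
open ExpKernelCalculus (hessKer tadpole)
open AffineAveraging (box toSite)
open AveragingMixedJetTables (vh₂SAt mixFFAt)
open OneStepKernelFamily (TbalOf D1Drift hTA_TbalOf)
open RateCertificate (CauchyRate)
open AxialDressing (axDressK axVertexOfK decays_axDressK)
open BalabanStepJetsSucc (JsBal0Of)
open BalabanStepW2 (WbalT2Of CwOf δwOf δwOf_pos WbalOf_loc₂)
open KernelReflection (tadpole_smul)
open ScalewiseWitness (secondMoment_add secondMoment_smul absMoment₂_const_mul)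
open Summit.QuantumFields.BalabanUV.Beta.TameKernelCalculus (Spr Loc tadpole_add)
open Summit.QuantumFields.BalabanUV.Beta.MixedJetTablesPlug (JsBalAn1 TbalOf_JsBalAn1 hB_an1 hmix_an1)
open Summit.QuantumFields.BalabanUV.Beta.GAN24.StencilSlotOfE3 (one_le_of_two_le)
open Summit.QuantumFields.BalabanUV.Gaps.CapTailPinnedLimitSign (tendsto_pinned d1Drift_pinned_iff_lim_eq)

namespace Summit.QuantumFields.BalabanUV.Gaps.D1PinnedPositionTableAffine

variable {d : ℕ} {Lc : ℕ} [NeZero Lc]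

/-! ## §0 Four small letters of `Gaps/D1PinnedBorderWeightAffine` (this seat, GEN 9), re-derived privately — statements and proofs verbatim -/

/-- [folklore] The value-4-jet read-out of `WbalOf … T₂ … j` is that of `WbalOf … 0 … j` plus `lin4 1 (KInvStep Lc j) Lc (T₂ j)` (PRIVATE twin of GEN 9's
`D1PinnedBorderWeightAffine.e4OfW_WbalOf_eq_base_add_lin4`). -/
private theorem e4OfW_WbalOf_eq_base_add_lin4 (hLc : 1 ≤ Lc) (cE cVH cΛ : ℝ)
    {T₂ : ℕ → Fin (d + 1) → (Fin (d + 1) → ℤ) → Fin (d + 1) → (Fin (d + 1) → ℤ) → MKer (d + 1) (Fib d)}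
    (hT₂ : ∀ j, ∃ C δ : ℝ, 0 < δ ∧ LocStencil₂ (T₂ j) C δ)
    {mixFF : Fin (d + 1) → (Fin (d + 1) → ℤ) → Fin (d + 1) → (Fin (d + 1) → ℤ) → MKer (d + 1) (Fib d)}
    (hmix : ∃ C δ : ℝ, 0 < δ ∧ LocStencilFM Lc mixFF C δ) (j : ℕ)
    (κ : Fin (d + 1)) (u : Fin (d + 1) → ℤ) (κ' : Fin (d + 1)) (u' : Fin (d + 1) → ℤ) :
    e4OfW d Lc j (Spure d Lc cE cVH cΛ j) (M1 d Lc cΛ j) (WbalOf d Lc cE cVH cΛ T₂ mixFF j) κ u κ' u' =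
      e4OfW d Lc j (Spure d Lc cE cVH cΛ j) (M1 d Lc cΛ j) (WbalOf d Lc cE cVH cΛ (fun _ => 0) mixFF j) κ u κ' u' +
        lin4 1 (KInvStep (d := d) Lc j) Lc (T₂ j) κ u κ' u' := by
  obtain ⟨δK, CK, hδK, hCK, hK⟩ := decays_KInvStep (Lc := Lc) (d := d) j
  have h0 : ∀ j, ∃ C δ : ℝ, 0 < δ ∧ LocStencil₂ ((fun _ : ℕ => (0 : Fin (d + 1) → (Fin (d + 1) → ℤ) → Fin (d + 1) → (Fin (d + 1) → ℤ) →
      MKer (d + 1) (Fib d))) j) C δ := fun _ => ⟨0, 1, one_pos, locStencil₂_zero 1⟩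
  obtain ⟨Cw, δw, hδw, hW⟩ := vertexFamily₂_WbalOf' (d := d) hLc cE cVH cΛ hT₂ hmix j
  obtain ⟨Cw₀, δw₀, hδw₀, hW₀⟩ := vertexFamily₂_WbalOf' (d := d) hLc cE cVH cΛ h0 hmix j
  set m : ℝ := min δK (min δw δw₀) with hm
  have hm0 : 0 < m := lt_min hδK (lt_min hδw hδw₀)
  have hKm : Decays (KInvStep (d := d) Lc j) CK m := decays_mono hK hCK le_rfl (min_le_left _ _)
  have hCw : 0 ≤ Cw := (hW 0 0 0 0).nonneg (Sum.inl 0)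
  have hCw₀ : 0 ≤ Cw₀ := (hW₀ 0 0 0 0).nonneg (Sum.inl 0)
  have hb : BiLoc (WbalOf d Lc cE cVH cΛ T₂ mixFF j κ u κ' u') ((Lc : ℤ) • u) ((Lc : ℤ) • u') Cw m :=
    biLoc_mono (hW κ u κ' u') hCw ((min_le_right _ _).trans (min_le_left _ _))
  have hb₀ : BiLoc (WbalOf d Lc cE cVH cΛ (fun _ => 0) mixFF j κ u κ' u') ((Lc : ℤ) • u) ((Lc : ℤ) • u') Cw₀ m :=
    biLoc_mono (hW₀ κ u κ' u') hCw₀ ((min_le_right _ _).trans (min_le_right _ _))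
  have hsplit : WbalOf d Lc cE cVH cΛ T₂ mixFF j = WbalOf d Lc cE cVH cΛ (fun _ => 0) mixFF j + vsym (KInvStep (d := d) Lc j) Lc (T₂ j) :=
    W2SymOfK_eq_add_vsym (KInvStep (d := d) Lc j) Lc _ _ _ _
  have hdiff : WbalOf d Lc cE cVH cΛ T₂ mixFF j κ u κ' u' - WbalOf d Lc cE cVH cΛ (fun _ => 0) mixFF j κ u κ' u' =
      vsym (KInvStep (d := d) Lc j) Lc (T₂ j) κ u κ' u' := by
    rw [hsplit]; simp only [Pi.add_apply, add_sub_cancel_left]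
  unfold BalabanStepW2.e4OfW
  rw [K3OfK_eq_sub_of_W hKm hm0 Lc _ _ hb hb₀, hdiff, mmRead_sub, lin4_apply, one_smul]
  abel

/-- [folklore] Entrywise bound of a scaled `LocStencil₂` table (PRIVATE twin of GEN 9's `D1PinnedBorderWeightAffine.abs_smul_le_of_locStencil₂`). -/
private theorem abs_smul_le_of_locStencil₂ (r : ℝ) {S₂ : Fin (d + 1) → (Fin (d + 1) → ℤ) → Fin (d + 1) → (Fin (d + 1) → ℤ) → MKer (d + 1) (Fib d)}
    {C δ : ℝ} (h : LocStencil₂ S₂ C δ) (hδ : 0 ≤ δ) {B : ℝ} (hB : |r| * C ≤ B)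
    (κ : Fin (d + 1)) (u : Fin (d + 1) → ℤ) (κ' : Fin (d + 1)) (u' x z : Fin (d + 1) → ℤ) (a b : Fib d) :
    |(r • S₂) κ u κ' u' x z a b| ≤ B := by
  have h1 := abs_le_of_locStencil₂ h hδ κ u κ' u' x z a b
  simp only [Pi.smul_apply, smul_eq_mul, abs_mul]
  exact (mul_le_mul_of_nonneg_left h1 (abs_nonneg r)).trans hB

section KernelLetters

variable {D : ℕ} {F : Type*} [Fintype F]

/-- [folklore] `hessKer` is affine in its W-slot (PRIVATE twin of GEN 9's `D1PinnedBorderWeightAffine.hessKer_affine_W`; `tadpole_add ∕ tadpole_smul`). -/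
private theorem hessKer_affine_W {A : MKer D F} (hA : Spr A) (V : Fin D → (Fin D → ℤ) → MKer D F)
    {W₀ W₁ : Fin D → (Fin D → ℤ) → Fin D → (Fin D → ℤ) → MKer D F} (c : ℝ) (μ ν : Fin D) (z : Fin D → ℤ)
    (h₀ : Loc (W₀ μ 0 ν z)) (h₁ : Loc (W₁ μ 0 ν z)) :
    hessKer A V ((1 - c) • W₀ + c • W₁) μ ν z = (1 - c) * hessKer A V W₀ μ ν z + c * hessKer A V W₁ μ ν z := by
  simp only [ExpKernelCalculus.hessKer, Pi.add_apply, Pi.smul_apply]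
  rw [tadpole_add hA (h₀.smul (1 - c)) (h₁.smul c), tadpole_smul, tadpole_smul]
  ring

end KernelLetters

/-- [folklore] The first-order part of an2's jet datum does not depend on the second-order tables or their certificates (PRIVATE twin of GEN 9's
`D1PinnedBorderWeightAffine.JsBal0Of_S_indep`; `rfl` by cases). -/
private theorem JsBal0Of_S_indep {Lc : ℕ} [NeZero Lc] (hLc : 1 ≤ Lc) (cE cVH cΛ : ℝ)
    (W W' : ℕ → Fin (3 + 1) → (Fin (3 + 1) → ℤ) → Fin (3 + 1) → (Fin (3 + 1) → ℤ) → MKer (3 + 1) (Fib 3))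
    (Cw δw : ℕ → ℝ) (hδw : ∀ j, 0 < δw j) (hW : ∀ j, VertexFamily₂ (W j) Lc (Cw j) (δw j))
    (Cw' δw' : ℕ → ℝ) (hδw' : ∀ j, 0 < δw' j) (hW' : ∀ j, VertexFamily₂ (W' j) Lc (Cw' j) (δw' j)) :
    ∀ j : ℕ, (JsBal0Of hLc cE cVH cΛ W Cw δw hδw hW j).S = (JsBal0Of hLc cE cVH cΛ W' Cw' δw' hδw' hW' j).S
  | 0 => rfl
  | _ + 1 => rfl

/-! ## §1 an2's recursive bi-stencil family is AFFINE in an3's position table along any line `s ↦ (1 − s)•T₀ + s•T₁` -/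

/-- [folklore] **`T2Of` IS AFFINE IN THE POSITION TABLE**: for `1 ≤ Lc`, a `LocStencil₂` border table `B`, a `LocStencilFM` mixed table and ANY other data, along
the line `s ↦ (1 − s)•T₀ + s•T₁` of an3's position tables, at every level `j`,
`T2Of d Lc cE cVH cΛ cE₂ cB ((1 − s)•T₀ + s•T₁) B mixFF j = (1 − s) • T2Of … T₀ … j + s • T2Of … T₁ … j`
— member `0` by an3's `wilsonW₂_add ∕ wilsonW₂_smul`; member `j+1` exactly as for the border weight (`D1PinnedBorderWeightAffine.e4OfW_WbalOf_eq_base_add_lin4`,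
`Lin4Additive.lin4_add ∕ lin4_smul` on bounded tables). -/
theorem T2Of_table_affine (hLc : 1 ≤ Lc) (cE cVH cΛ cE₂ cB : ℝ) (T₀ T₁ : Fin 4 → Fin 4 → Fin 4 → Fin 4 → ℝ) (s : ℝ)
    {B : Fin (d + 1) → (Fin (d + 1) → ℤ) → Fin (d + 1) → (Fin (d + 1) → ℤ) → MKer (d + 1) (Fib d)}
    (hB : ∃ C δ : ℝ, 0 < δ ∧ LocStencil₂ B C δ)
    {mixFF : Fin (d + 1) → (Fin (d + 1) → ℤ) → Fin (d + 1) → (Fin (d + 1) → ℤ) → MKer (d + 1) (Fib d)}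
    (hmix : ∃ C δ : ℝ, 0 < δ ∧ LocStencilFM Lc mixFF C δ) :
    ∀ j : ℕ, T2Of d Lc cE cVH cΛ cE₂ cB ((1 - s) • T₀ + s • T₁) B mixFF j =
      (1 - s) • T2Of d Lc cE cVH cΛ cE₂ cB T₀ B mixFF j + s • T2Of d Lc cE cVH cΛ cE₂ cB T₁ B mixFF j
  | 0 => by
    funext κ u κ' u' x z a b
    simp only [T2Of_zero]
    rw [wilsonW₂_add, wilsonW₂_smul, wilsonW₂_smul]
    simp only [Pi.add_apply, Pi.smul_apply, smul_eq_mul]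
    ring
  | j + 1 => by
    have IH := T2Of_table_affine hLc cE cVH cΛ cE₂ cB T₀ T₁ s hB hmix j
    obtain ⟨C0, δ0, hδ0, hL0⟩ := T2Of_loc (d := d) hLc cE cVH cΛ cE₂ cB T₀ hB hmix j
    obtain ⟨C1, δ1, hδ1, hL1⟩ := T2Of_loc (d := d) hLc cE cVH cΛ cE₂ cB T₁ hB hmix j
    obtain ⟨δK, CK, hδK, -, hK⟩ := decays_KInvStep (Lc := Lc) (d := d) j
    have hC0 : 0 ≤ C0 := (abs_nonneg _).trans (abs_le_of_locStencil₂ hL0 hδ0.le 0 0 0 0 0 0 (Sum.inl 0) (Sum.inl 0))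
    have hC1 : 0 ≤ C1 := (abs_nonneg _).trans (abs_le_of_locStencil₂ hL1 hδ1.le 0 0 0 0 0 0 (Sum.inl 0) (Sum.inl 0))
    have hb0 : ∀ κ u κ' u' x z a b, |((1 - s) • T2Of d Lc cE cVH cΛ cE₂ cB T₀ B mixFF j) κ u κ' u' x z a b| ≤ |1 - s| * C0 + |s| * C1 :=
      fun κ u κ' u' x z a b => abs_smul_le_of_locStencil₂ (1 - s) hL0 hδ0.le
        (le_add_of_nonneg_right (mul_nonneg (abs_nonneg _) hC1)) κ u κ' u' x z a b
    have hb1 : ∀ κ u κ' u' x z a b, |(s • T2Of d Lc cE cVH cΛ cE₂ cB T₁ B mixFF j) κ u κ' u' x z a b| ≤ |1 - s| * C0 + |s| * C1 :=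
      fun κ u κ' u' x z a b => abs_smul_le_of_locStencil₂ s hL1 hδ1.le
        (le_add_of_nonneg_left (mul_nonneg (abs_nonneg _) hC0)) κ u κ' u' x z a b
    have hlin : lin4 1 (KInvStep (d := d) Lc j) Lc (T2Of d Lc cE cVH cΛ cE₂ cB ((1 - s) • T₀ + s • T₁) B mixFF j) =
        (1 - s) • lin4 1 (KInvStep (d := d) Lc j) Lc (T2Of d Lc cE cVH cΛ cE₂ cB T₀ B mixFF j) +
          s • lin4 1 (KInvStep (d := d) Lc j) Lc (T2Of d Lc cE cVH cΛ cE₂ cB T₁ B mixFF j) := by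
      rw [IH, lin4_add hK hδK 1 Lc hb0 hb1, lin4_smul, lin4_smul]
    funext κ u κ' u' x z a b
    simp only [T2Of_succ, Pi.add_apply, Pi.smul_apply]
    rw [e4OfW_WbalOf_eq_base_add_lin4 hLc cE cVH cΛ (T2Of_loc (d := d) hLc cE cVH cΛ cE₂ cB ((1 - s) • T₀ + s • T₁) hB hmix) hmix j,
      e4OfW_WbalOf_eq_base_add_lin4 hLc cE cVH cΛ (T2Of_loc (d := d) hLc cE cVH cΛ cE₂ cB T₀ hB hmix) hmix j,
      e4OfW_WbalOf_eq_base_add_lin4 hLc cE cVH cΛ (T2Of_loc (d := d) hLc cE cVH cΛ cE₂ cB T₁ hB hmix) hmix j, hlin]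
    simp only [Pi.add_apply, Pi.smul_apply, smul_eq_mul]
    ring

/-! ## §2 The assembled second-order family is AFFINE along the table line -/

/-- [folklore] **an2's assembled second-order family is AFFINE along the table line** (`W2SymOfK_eq_add_vsym`, `vsym_add ∕ vsym_smul`, §1). -/
theorem WbalOf_T2Of_table_affine (hLc : 1 ≤ Lc) (cE cVH cΛ cE₂ cB : ℝ) (T₀ T₁ : Fin 4 → Fin 4 → Fin 4 → Fin 4 → ℝ) (s : ℝ)
    {B : Fin (d + 1) → (Fin (d + 1) → ℤ) → Fin (d + 1) → (Fin (d + 1) → ℤ) → MKer (d + 1) (Fib d)}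
    (hB : ∃ C δ : ℝ, 0 < δ ∧ LocStencil₂ B C δ)
    {mixFF : Fin (d + 1) → (Fin (d + 1) → ℤ) → Fin (d + 1) → (Fin (d + 1) → ℤ) → MKer (d + 1) (Fib d)}
    (hmix : ∃ C δ : ℝ, 0 < δ ∧ LocStencilFM Lc mixFF C δ) (j : ℕ) :
    WbalOf d Lc cE cVH cΛ (T2Of d Lc cE cVH cΛ cE₂ cB ((1 - s) • T₀ + s • T₁) B mixFF) mixFF j =
      (1 - s) • WbalOf d Lc cE cVH cΛ (T2Of d Lc cE cVH cΛ cE₂ cB T₀ B mixFF) mixFF j +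
        s • WbalOf d Lc cE cVH cΛ (T2Of d Lc cE cVH cΛ cE₂ cB T₁ B mixFF) mixFF j := by
  obtain ⟨C0, δ0, hδ0, hL0⟩ := T2Of_loc (d := d) hLc cE cVH cΛ cE₂ cB T₀ hB hmix j
  obtain ⟨C1, δ1, hδ1, hL1⟩ := T2Of_loc (d := d) hLc cE cVH cΛ cE₂ cB T₁ hB hmix j
  obtain ⟨δK, CK, hδK, -, hK⟩ := decays_KInvStep (Lc := Lc) (d := d) j
  have hC0 : 0 ≤ C0 := (abs_nonneg _).trans (abs_le_of_locStencil₂ hL0 hδ0.le 0 0 0 0 0 0 (Sum.inl 0) (Sum.inl 0))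
  have hC1 : 0 ≤ C1 := (abs_nonneg _).trans (abs_le_of_locStencil₂ hL1 hδ1.le 0 0 0 0 0 0 (Sum.inl 0) (Sum.inl 0))
  have hb0 : ∀ κ u κ' u' x z a b, |((1 - s) • T2Of d Lc cE cVH cΛ cE₂ cB T₀ B mixFF j) κ u κ' u' x z a b| ≤ |1 - s| * C0 + |s| * C1 :=
    fun κ u κ' u' x z a b => abs_smul_le_of_locStencil₂ (1 - s) hL0 hδ0.le
      (le_add_of_nonneg_right (mul_nonneg (abs_nonneg _) hC1)) κ u κ' u' x z a b
  have hb1 : ∀ κ u κ' u' x z a b, |(s • T2Of d Lc cE cVH cΛ cE₂ cB T₁ B mixFF j) κ u κ' u' x z a b| ≤ |1 - s| * C0 + |s| * C1 :=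
    fun κ u κ' u' x z a b => abs_smul_le_of_locStencil₂ s hL1 hδ1.le
      (le_add_of_nonneg_left (mul_nonneg (abs_nonneg _) hC0)) κ u κ' u' x z a b
  unfold BalabanStepW2.WbalOf
  rw [W2SymOfK_eq_add_vsym (KInvStep (d := d) Lc j) Lc _ _ (T2Of d Lc cE cVH cΛ cE₂ cB ((1 - s) • T₀ + s • T₁) B mixFF j),
    W2SymOfK_eq_add_vsym (KInvStep (d := d) Lc j) Lc _ _ (T2Of d Lc cE cVH cΛ cE₂ cB T₀ B mixFF j),
    W2SymOfK_eq_add_vsym (KInvStep (d := d) Lc j) Lc _ _ (T2Of d Lc cE cVH cΛ cE₂ cB T₁ B mixFF j),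
    T2Of_table_affine hLc cE cVH cΛ cE₂ cB T₀ T₁ s hB hmix j]
  funext μ y ν y' x z a b
  simp only [Pi.add_apply, Pi.smul_apply, smul_eq_mul]
  rw [vsym_add hK hδK Lc hb0 hb1, vsym_smul, vsym_smul]
  simp only [Pi.add_apply, Pi.smul_apply, smul_eq_mul]
  ring

/-! ## §3 At `d = 3` the pinned literal's step kernels and (1.22) coefficients are affine along the table line -/


section Pinned

variable {Lc : ℕ} [NeZero Lc] {r : Fin (3 + 1) → ℕ}

/-- [folklore] **THE PINNED LITERAL's STEP KERNELS ARE AFFINE ALONG THE TABLE LINE** (any `cE₂`, `cB`, box root, level, entry). -/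
theorem TbalOf_JsBalAn1_table_affine (hLc : 1 ≤ Lc) (hr : r ∈ box (3 + 1) Lc) (cE cVH cΛ cE₂ cB : ℝ)
    (T₀ T₁ : Fin 4 → Fin 4 → Fin 4 → Fin 4 → ℝ) (s : ℝ) (j : ℕ) (μ ν : Fin 4) (z : Fin 4 → ℤ) :
    TbalOf Lc (JsBalAn1 hLc hr cE cVH cΛ cE₂ cB ((1 - s) • T₀ + s • T₁)) j μ ν z =
      (1 - s) * TbalOf Lc (JsBalAn1 hLc hr cE cVH cΛ cE₂ cB T₀) j μ ν z + s * TbalOf Lc (JsBalAn1 hLc hr cE cVH cΛ cE₂ cB T₁) j μ ν z := by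
  rw [TbalOf_JsBalAn1 hLc hr cE cVH cΛ cE₂ cB ((1 - s) • T₀ + s • T₁) j, TbalOf_JsBalAn1 hLc hr cE cVH cΛ cE₂ cB T₀ j, TbalOf_JsBalAn1 hLc hr cE cVH cΛ cE₂ cB T₁ j]
  rw [JsBal0Of_S_indep hLc cE cVH cΛ (WbalT2Of (Lc := Lc) cE cVH cΛ cE₂ cB ((1 - s) • T₀ + s • T₁) (vh₂S := vh₂SAt (toSite r) Lc) (mixFF := mixFFAt (toSite r) Lc))
      (WbalT2Of (Lc := Lc) cE cVH cΛ cE₂ cB T₁ (vh₂S := vh₂SAt (toSite r) Lc) (mixFF := mixFFAt (toSite r) Lc)) _ _ _ _ _ _ _ _ j,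
    JsBal0Of_S_indep hLc cE cVH cΛ (WbalT2Of (Lc := Lc) cE cVH cΛ cE₂ cB T₀ (vh₂S := vh₂SAt (toSite r) Lc) (mixFF := mixFFAt (toSite r) Lc))
      (WbalT2Of (Lc := Lc) cE cVH cΛ cE₂ cB T₁ (vh₂S := vh₂SAt (toSite r) Lc) (mixFF := mixFFAt (toSite r) Lc)) _ _ _ _ _ _ _ _ j]
  have hW : WbalT2Of (Lc := Lc) cE cVH cΛ cE₂ cB ((1 - s) • T₀ + s • T₁) (vh₂S := vh₂SAt (toSite r) Lc) (mixFF := mixFFAt (toSite r) Lc) j =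
      (1 - s) • WbalT2Of (Lc := Lc) cE cVH cΛ cE₂ cB T₀ (vh₂S := vh₂SAt (toSite r) Lc) (mixFF := mixFFAt (toSite r) Lc) j +
        s • WbalT2Of (Lc := Lc) cE cVH cΛ cE₂ cB T₁ (vh₂S := vh₂SAt (toSite r) Lc) (mixFF := mixFFAt (toSite r) Lc) j :=
    WbalOf_T2Of_table_affine hLc cE cVH cΛ cE₂ cB T₀ T₁ s (hB_an1 hLc hr) (hmix_an1 hLc hr) j
  rw [hW]
  obtain ⟨δK, CK, hδK, -, hK⟩ := decays_KInvStep (Lc := Lc) (d := 3) j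
  have hA : Spr (axDressK Lc (KInvStep (d := 3) Lc j)) := ⟨_, δK, hδK, decays_axDressK hLc hK hδK.le⟩
  obtain ⟨Cw0, δw0, hδw0, hW0⟩ := vertexFamily₂_WbalOf' (d := 3) hLc cE cVH cΛ
    (T2Of_loc (d := 3) hLc cE cVH cΛ cE₂ cB T₀ (hB_an1 hLc hr) (hmix_an1 hLc hr)) (hmix_an1 hLc hr) j
  obtain ⟨Cw1, δw1, hδw1, hW1⟩ := vertexFamily₂_WbalOf' (d := 3) hLc cE cVH cΛ
    (T2Of_loc (d := 3) hLc cE cVH cΛ cE₂ cB T₁ (hB_an1 hLc hr) (hmix_an1 hLc hr)) (hmix_an1 hLc hr) j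
  exact hessKer_affine_W hA _ s μ ν z ⟨_, _, _, _, hδw0, hW0 μ 0 ν z⟩ ⟨_, _, _, _, hδw1, hW1 μ 0 ν z⟩

/-- [folklore] **THE PINNED LITERAL's ONE-LOOP STEP COEFFICIENTS ARE AFFINE ALONG THE TABLE LINE** (any `cE₂`, `cB`, box root, level, channel). -/
theorem secondMoment_JsBalAn1_table_affine (hLc : 1 ≤ Lc) (hr : r ∈ box (3 + 1) Lc) (cE cVH cΛ cE₂ cB : ℝ)
    (T₀ T₁ : Fin 4 → Fin 4 → Fin 4 → Fin 4 → ℝ) (s : ℝ) (j : ℕ) (μ ν : Fin 4) :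
    B12Beta.secondMoment (TbalOf Lc (JsBalAn1 hLc hr cE cVH cΛ cE₂ cB ((1 - s) • T₀ + s • T₁)) j) μ ν =
      (1 - s) * B12Beta.secondMoment (TbalOf Lc (JsBalAn1 hLc hr cE cVH cΛ cE₂ cB T₀) j) μ ν +
        s * B12Beta.secondMoment (TbalOf Lc (JsBalAn1 hLc hr cE cVH cΛ cE₂ cB T₁) j) μ ν := by
  have hker : TbalOf Lc (JsBalAn1 hLc hr cE cVH cΛ cE₂ cB ((1 - s) • T₀ + s • T₁)) j =
      (1 - s) • TbalOf Lc (JsBalAn1 hLc hr cE cVH cΛ cE₂ cB T₀) j + s • TbalOf Lc (JsBalAn1 hLc hr cE cVH cΛ cE₂ cB T₁) j := by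
    funext μ' ν' z
    simp only [Pi.add_apply, Pi.smul_apply, smul_eq_mul]
    exact TbalOf_JsBalAn1_table_affine hLc hr cE cVH cΛ cE₂ cB T₀ T₁ s j μ' ν' z
  have h0 : ∀ c e, DecimatedMomentSummable.AbsMoment₂ (((1 - s) • TbalOf Lc (JsBalAn1 hLc hr cE cVH cΛ cE₂ cB T₀) j) c e) :=
    fun c e => absMoment₂_const_mul (hTA_TbalOf (JsBalAn1 hLc hr cE cVH cΛ cE₂ cB T₀) j c e) (1 - s)
  have h1 : ∀ c e, DecimatedMomentSummable.AbsMoment₂ ((s • TbalOf Lc (JsBalAn1 hLc hr cE cVH cΛ cE₂ cB T₁) j) c e) :=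
    fun c e => absMoment₂_const_mul (hTA_TbalOf (JsBalAn1 hLc hr cE cVH cΛ cE₂ cB T₁) j c e) s
  rw [hker, secondMoment_add h0 h1, secondMoment_smul, secondMoment_smul]

end Pinned

/-! ## §4 UNCONDITIONAL consequences at the pin `cE₂ := Lc^8`, `2 ≤ Lc`: the limit is affine along every table line; (D1) at the pinned literal is blind to the line or met at exactly one of its points -/

section Consequences

variable {Lc : ℕ} [NeZero Lc] {r : Fin (3 + 1) → ℕ}

/-- [folklore] **THE LIMIT OF THE PINNED LITERAL's ONE-LOOP COEFFICIENTS IS AFFINE ALONG EVERY LINE OF POSITION TABLES, HYPOTHESIS-FREE**: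
`lim β⁰((1−s)T₀ + sT₁) = (1 − s)·lim β⁰(T₀) + s·lim β⁰(T₁)` (§3 at every level + gan24-p1's convergence via g1-p3's `tendsto_pinned` + `tendsto_nhds_unique`). -/
theorem lim_JsBalAn1_table_affine (hLc : 2 ≤ Lc) (hr : r ∈ box (3 + 1) Lc) (cE cVH cΛ cB : ℝ)
    (T₀ T₁ : Fin 4 → Fin 4 → Fin 4 → Fin 4 → ℝ) (s : ℝ) (μ ν : Fin 4) :
    CauchyRate.lim (fun j => B12Beta.secondMoment (TbalOf Lc (JsBalAn1 (one_le_of_two_le hLc) hr cE cVH cΛ ((Lc : ℝ) ^ (2 * (3 + 1))) cB ((1 - s) • T₀ + s • T₁)) j) μ ν) =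
      (1 - s) * CauchyRate.lim (fun j => B12Beta.secondMoment (TbalOf Lc (JsBalAn1 (one_le_of_two_le hLc) hr cE cVH cΛ ((Lc : ℝ) ^ (2 * (3 + 1))) cB T₀) j) μ ν) +
        s * CauchyRate.lim (fun j => B12Beta.secondMoment (TbalOf Lc (JsBalAn1 (one_le_of_two_le hLc) hr cE cVH cΛ ((Lc : ℝ) ^ (2 * (3 + 1))) cB T₁) j) μ ν) := by
  have hc := tendsto_pinned hLc hr cE cVH cΛ cB ((1 - s) • T₀ + s • T₁) μ ν
  have h0 := tendsto_pinned hLc hr cE cVH cΛ cB T₀ μ ν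
  have h1 := tendsto_pinned hLc hr cE cVH cΛ cB T₁ μ ν
  have h' := (h0.const_mul (1 - s)).add (h1.const_mul s)
  exact tendsto_nhds_unique hc (h'.congr fun j =>
    (secondMoment_JsBalAn1_table_affine (one_le_of_two_le hLc) hr cE cVH cΛ _ cB T₀ T₁ s j μ ν).symm)

/-- [folklore] **BLIND CASE**: if `lim β⁰(T₁) = lim β⁰(T₀)` then (D1) at the pinned literal does not see the position along the line `T₀T₁` (g1-p3's `d1Drift_pinned_iff_lim_eq` twice). -/
theorem d1Drift_JsBalAn1_iff_base_of_tableBlind (hLc : 2 ≤ Lc) (hr : r ∈ box (3 + 1) Lc) (cE cVH cΛ cB : ℝ)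
    (T₀ T₁ : Fin 4 → Fin 4 → Fin 4 → Fin 4 → ℝ) (μ ν : Fin 4)
    (hblind : CauchyRate.lim (fun j => B12Beta.secondMoment (TbalOf Lc (JsBalAn1 (one_le_of_two_le hLc) hr cE cVH cΛ ((Lc : ℝ) ^ (2 * (3 + 1))) cB T₁) j) μ ν) =
      CauchyRate.lim (fun j => B12Beta.secondMoment (TbalOf Lc (JsBalAn1 (one_le_of_two_le hLc) hr cE cVH cΛ ((Lc : ℝ) ^ (2 * (3 + 1))) cB T₀) j) μ ν))
    (s N : ℝ) :
    D1Drift Lc (JsBalAn1 (one_le_of_two_le hLc) hr cE cVH cΛ ((Lc : ℝ) ^ (2 * (3 + 1))) cB ((1 - s) • T₀ + s • T₁)) N μ ν ↔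
      D1Drift Lc (JsBalAn1 (one_le_of_two_le hLc) hr cE cVH cΛ ((Lc : ℝ) ^ (2 * (3 + 1))) cB T₀) N μ ν := by
  rw [d1Drift_pinned_iff_lim_eq hLc hr cE cVH cΛ cB ((1 - s) • T₀ + s • T₁) μ ν N, d1Drift_pinned_iff_lim_eq hLc hr cE cVH cΛ cB T₀ μ ν N,
    lim_JsBalAn1_table_affine hLc hr cE cVH cΛ cB T₀ T₁ s μ ν, hblind]
  constructor
  · intro h; linear_combination h
  · intro h; linear_combination h

/-- [folklore] **GENERIC CASE, SURJECTIVITY**: if `lim β⁰(T₁) ≠ lim β⁰(T₀)` then the limit takes EVERY real value along the table line (hypothesis-free). -/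
theorem exists_tableLine_lim_eq (hLc : 2 ≤ Lc) (hr : r ∈ box (3 + 1) Lc) (cE cVH cΛ cB : ℝ)
    (T₀ T₁ : Fin 4 → Fin 4 → Fin 4 → Fin 4 → ℝ) (μ ν : Fin 4)
    (hgen : CauchyRate.lim (fun j => B12Beta.secondMoment (TbalOf Lc (JsBalAn1 (one_le_of_two_le hLc) hr cE cVH cΛ ((Lc : ℝ) ^ (2 * (3 + 1))) cB T₁) j) μ ν) ≠
      CauchyRate.lim (fun j => B12Beta.secondMoment (TbalOf Lc (JsBalAn1 (one_le_of_two_le hLc) hr cE cVH cΛ ((Lc : ℝ) ^ (2 * (3 + 1))) cB T₀) j) μ ν))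
    (t : ℝ) :
    ∃ s : ℝ, CauchyRate.lim (fun j => B12Beta.secondMoment (TbalOf Lc (JsBalAn1 (one_le_of_two_le hLc) hr cE cVH cΛ ((Lc : ℝ) ^ (2 * (3 + 1))) cB ((1 - s) • T₀ + s • T₁)) j) μ ν) = t := by
  refine ⟨(t - CauchyRate.lim (fun j => B12Beta.secondMoment (TbalOf Lc (JsBalAn1 (one_le_of_two_le hLc) hr cE cVH cΛ ((Lc : ℝ) ^ (2 * (3 + 1))) cB T₀) j) μ ν)) /
      (CauchyRate.lim (fun j => B12Beta.secondMoment (TbalOf Lc (JsBalAn1 (one_le_of_two_le hLc) hr cE cVH cΛ ((Lc : ℝ) ^ (2 * (3 + 1))) cB T₁) j) μ ν) -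
        CauchyRate.lim (fun j => B12Beta.secondMoment (TbalOf Lc (JsBalAn1 (one_le_of_two_le hLc) hr cE cVH cΛ ((Lc : ℝ) ^ (2 * (3 + 1))) cB T₀) j) μ ν)), ?_⟩
  rw [lim_JsBalAn1_table_affine hLc hr cE cVH cΛ cB T₀ T₁ _ μ ν]
  have hne := sub_ne_zero.mpr hgen
  field_simp
  ring

/-- [folklore] **GENERIC CASE: (D1) AT THE PINNED LITERAL PICKS EXACTLY ONE POINT OF THE TABLE LINE, HYPOTHESIS-FREE** — if `lim β⁰(T₁) ≠ lim β⁰(T₀)` then for EVERY numeral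
there is EXACTLY ONE `s` with `D1Drift Lc (JsBalAn1 … ((1−s)•T₀ + s•T₁)) N μ ν`. -/
theorem existsUnique_tableLine_d1Drift (hLc : 2 ≤ Lc) (hr : r ∈ box (3 + 1) Lc) (cE cVH cΛ cB : ℝ)
    (T₀ T₁ : Fin 4 → Fin 4 → Fin 4 → Fin 4 → ℝ) (μ ν : Fin 4)
    (hgen : CauchyRate.lim (fun j => B12Beta.secondMoment (TbalOf Lc (JsBalAn1 (one_le_of_two_le hLc) hr cE cVH cΛ ((Lc : ℝ) ^ (2 * (3 + 1))) cB T₁) j) μ ν) ≠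
      CauchyRate.lim (fun j => B12Beta.secondMoment (TbalOf Lc (JsBalAn1 (one_le_of_two_le hLc) hr cE cVH cΛ ((Lc : ℝ) ^ (2 * (3 + 1))) cB T₀) j) μ ν))
    (N : ℝ) :
    ∃! s : ℝ, D1Drift Lc (JsBalAn1 (one_le_of_two_le hLc) hr cE cVH cΛ ((Lc : ℝ) ^ (2 * (3 + 1))) cB ((1 - s) • T₀ + s • T₁)) N μ ν := by
  obtain ⟨s₀, hs₀⟩ := exists_tableLine_lim_eq hLc hr cE cVH cΛ cB T₀ T₁ μ ν hgen (B12Normalization.stepBal N Lc)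
  refine ⟨s₀, (d1Drift_pinned_iff_lim_eq hLc hr cE cVH cΛ cB _ μ ν N).mpr hs₀, fun s₁ hs₁ => ?_⟩
  have h2 := (d1Drift_pinned_iff_lim_eq hLc hr cE cVH cΛ cB _ μ ν N).mp hs₁
  have h1' := (d1Drift_pinned_iff_lim_eq hLc hr cE cVH cΛ cB _ μ ν N).mp ((d1Drift_pinned_iff_lim_eq hLc hr cE cVH cΛ cB _ μ ν N).mpr hs₀)
  rw [lim_JsBalAn1_table_affine hLc hr cE cVH cΛ cB T₀ T₁ _ μ ν] at h1' h2
  have hne := sub_ne_zero.mpr hgen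
  have hkey : (s₁ - s₀) * (CauchyRate.lim (fun j => B12Beta.secondMoment (TbalOf Lc (JsBalAn1 (one_le_of_two_le hLc) hr cE cVH cΛ ((Lc : ℝ) ^ (2 * (3 + 1))) cB T₁) j) μ ν) -
      CauchyRate.lim (fun j => B12Beta.secondMoment (TbalOf Lc (JsBalAn1 (one_le_of_two_le hLc) hr cE cVH cΛ ((Lc : ℝ) ^ (2 * (3 + 1))) cB T₀) j) μ ν)) = 0 := by
    linear_combination h2 - h1'
  rcases mul_eq_zero.mp hkey with h | h
  · linarith
  · exact absurd h hne

/-- [folklore] **GENERIC CASE: THE END BIT VARIES ALONG THE TABLE LINE, HYPOTHESIS-FREE** — some point of the line makes `0 < lim β⁰` hold and another makes it fail. -/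
theorem exists_tableLine_limPos_and_limNeg (hLc : 2 ≤ Lc) (hr : r ∈ box (3 + 1) Lc) (cE cVH cΛ cB : ℝ)
    (T₀ T₁ : Fin 4 → Fin 4 → Fin 4 → Fin 4 → ℝ) (μ ν : Fin 4)
    (hgen : CauchyRate.lim (fun j => B12Beta.secondMoment (TbalOf Lc (JsBalAn1 (one_le_of_two_le hLc) hr cE cVH cΛ ((Lc : ℝ) ^ (2 * (3 + 1))) cB T₁) j) μ ν) ≠
      CauchyRate.lim (fun j => B12Beta.secondMoment (TbalOf Lc (JsBalAn1 (one_le_of_two_le hLc) hr cE cVH cΛ ((Lc : ℝ) ^ (2 * (3 + 1))) cB T₀) j) μ ν)) :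
    (∃ s : ℝ, 0 < CauchyRate.lim (fun j => B12Beta.secondMoment (TbalOf Lc (JsBalAn1 (one_le_of_two_le hLc) hr cE cVH cΛ ((Lc : ℝ) ^ (2 * (3 + 1))) cB ((1 - s) • T₀ + s • T₁)) j) μ ν)) ∧
    (∃ s : ℝ, CauchyRate.lim (fun j => B12Beta.secondMoment (TbalOf Lc (JsBalAn1 (one_le_of_two_le hLc) hr cE cVH cΛ ((Lc : ℝ) ^ (2 * (3 + 1))) cB ((1 - s) • T₀ + s • T₁)) j) μ ν) < 0) := by
  obtain ⟨c₁, hc₁⟩ := exists_tableLine_lim_eq hLc hr cE cVH cΛ cB T₀ T₁ μ ν hgen 1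
  obtain ⟨c₂, hc₂⟩ := exists_tableLine_lim_eq hLc hr cE cVH cΛ cB T₀ T₁ μ ν hgen (-1)
  exact ⟨⟨c₁, by rw [hc₁]; exact one_pos⟩, ⟨c₂, by rw [hc₂]; norm_num⟩⟩

/-! ## §5 The TABLE RESPONSE is a LINEAR functional on position tables (hypothesis-free at the pin) -/

/-- [folklore] **HOMOGENEITY OF THE TABLE RESPONSE**: `lim β⁰(cB, s•T) = (1 − s)·lim β⁰(cB, 0) + s·lim β⁰(cB, T)` — i.e. `lim β⁰(cB, s•T) − lim β⁰(cB, 0) = s·(lim β⁰(cB,T) − lim β⁰(cB,0))`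
(§4 on the line through the zero table and `T`). -/
theorem lim_JsBalAn1_table_smul (hLc : 2 ≤ Lc) (hr : r ∈ box (3 + 1) Lc) (cE cVH cΛ cB : ℝ)
    (T : Fin 4 → Fin 4 → Fin 4 → Fin 4 → ℝ) (s : ℝ) (μ ν : Fin 4) :
    CauchyRate.lim (fun j => B12Beta.secondMoment (TbalOf Lc (JsBalAn1 (one_le_of_two_le hLc) hr cE cVH cΛ ((Lc : ℝ) ^ (2 * (3 + 1))) cB (s • T)) j) μ ν) =
      (1 - s) * CauchyRate.lim (fun j => B12Beta.secondMoment (TbalOf Lc (JsBalAn1 (one_le_of_two_le hLc) hr cE cVH cΛ ((Lc : ℝ) ^ (2 * (3 + 1))) cB 0) j) μ ν) +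
        s * CauchyRate.lim (fun j => B12Beta.secondMoment (TbalOf Lc (JsBalAn1 (one_le_of_two_le hLc) hr cE cVH cΛ ((Lc : ℝ) ^ (2 * (3 + 1))) cB T) j) μ ν) := by
  have h := lim_JsBalAn1_table_affine hLc hr cE cVH cΛ cB 0 T s μ ν
  have e : ((1 : ℝ) - s) • (0 : Fin 4 → Fin 4 → Fin 4 → Fin 4 → ℝ) + s • T = s • T := by rw [smul_zero, zero_add]
  rw [e] at h
  exact h

/-- [folklore] **ADDITIVITY OF THE TABLE RESPONSE**: `lim β⁰(cB, T₀ + T₁) + lim β⁰(cB, 0) = lim β⁰(cB, T₀) + lim β⁰(cB, T₁)` (§4 on the line through `2•T₀` and `2•T₁` at its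
midpoint, and `lim_JsBalAn1_table_smul` ×2).  READING: with `lim_JsBalAn1_table_smul`, the table response `Tc ↦ lim β⁰(cB,Tc) − lim β⁰(cB,0)` is a LINEAR functional on
the real vector space of position tables `Fin 4 → Fin 4 → Fin 4 → Fin 4 → ℝ`; (D1) at the pinned literal, at fixed `cB`, is the affine hyperplane equation
`λ_cB(Tc) = stepBal N Lc − lim β⁰(cB,0)` unless `λ_cB = 0`. -/
theorem lim_JsBalAn1_table_add (hLc : 2 ≤ Lc) (hr : r ∈ box (3 + 1) Lc) (cE cVH cΛ cB : ℝ)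
    (T₀ T₁ : Fin 4 → Fin 4 → Fin 4 → Fin 4 → ℝ) (μ ν : Fin 4) :
    CauchyRate.lim (fun j => B12Beta.secondMoment (TbalOf Lc (JsBalAn1 (one_le_of_two_le hLc) hr cE cVH cΛ ((Lc : ℝ) ^ (2 * (3 + 1))) cB (T₀ + T₁)) j) μ ν) +
        CauchyRate.lim (fun j => B12Beta.secondMoment (TbalOf Lc (JsBalAn1 (one_le_of_two_le hLc) hr cE cVH cΛ ((Lc : ℝ) ^ (2 * (3 + 1))) cB 0) j) μ ν) =
      CauchyRate.lim (fun j => B12Beta.secondMoment (TbalOf Lc (JsBalAn1 (one_le_of_two_le hLc) hr cE cVH cΛ ((Lc : ℝ) ^ (2 * (3 + 1))) cB T₀) j) μ ν) +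
        CauchyRate.lim (fun j => B12Beta.secondMoment (TbalOf Lc (JsBalAn1 (one_le_of_two_le hLc) hr cE cVH cΛ ((Lc : ℝ) ^ (2 * (3 + 1))) cB T₁) j) μ ν) := by
  have hmid := lim_JsBalAn1_table_affine hLc hr cE cVH cΛ cB ((2 : ℝ) • T₀) ((2 : ℝ) • T₁) (1 / 2) μ ν
  have e : ((1 : ℝ) - 1 / 2) • ((2 : ℝ) • T₀) + (1 / 2 : ℝ) • ((2 : ℝ) • T₁) = T₀ + T₁ := by
    rw [smul_smul, smul_smul]; norm_num
  rw [e] at hmid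
  have h0 := lim_JsBalAn1_table_smul hLc hr cE cVH cΛ cB T₀ 2 μ ν
  have h1 := lim_JsBalAn1_table_smul hLc hr cE cVH cΛ cB T₁ 2 μ ν
  rw [h0, h1] at hmid
  linear_combination hmid

end Consequences

end Summit.QuantumFields.BalabanUV.Gaps.D1PinnedPositionTableAffine

end
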